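import Summits.QuantumFields.BalabanUV.Beta.GAN24.RelInvWardPairing
import Summits.QuantumFields.BalabanUV.Beta.RelInvBorderedHessianStep
import Summits.QuantumFields.BalabanUV.Beta.GAN24.TransverseDictionary
import Summits.QuantumFields.BalabanUV.Beta.GAN24.MultiplierZeroMass

/-!
# `BalabanUV.Beta.GAN24.RelInvWardPairingStep` — binder row G-an2-4 ∕ (CONV-C), the (S) row ∕ (W-γ) AT EVERY LEVEL («the Δ_j-exact charge tower», road-P2 gen 41, memo
# `HOME/b2b-balaban-gan24-p2/gen41/W-GAMMA-TOWER-v0.md`, identity (I4)): **THE RELATIVE-INVERSE WARD PAIRING AT STEP `j + 1`** — leaf-06 g46's `RelInvWardPairing.ward_pairing`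
# (`RelInv G (bhK N) (axEc ρ N)`, field block `curvAdj ∘ curv`) with an2's STRAIGHT STEP CANDIDATE `bhKStep d Lc (j+1)` in place of `bhK`: field block `wVH_{j+1}·E2_{j+1}`
# (the value Hessian `wΦ_{Lc^{j+1}}`), border `stepScale_{j+1}·𝒬ᵀ_{Lc}`, multiplier block `0`

NOT IN PRINT; OUR BOOKKEEPING ([folklore]: the proof of leaf-06 g46's §2–§3 verbatim with `comp_bhKStep_succ_inl` (an2, `BorderedHessianStepStraight`) for `comp_bhK_inl`, one Fubini for the
(non-local but decaying) value Hessian, the symmetry `TransverseDictionary.wΦ_symm`, and leaf-06's adjointness `tsum_mul_contourSumAdj_bdd` BY NAME; the instance uses an2's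
`RelInvBorderedHessianStep.relInv_coDressKBmAt_KInvStep_succ_bhKStep`; 0 `def`, 0 cited fact, 0 `def … : Prop`, 0 sorry).  FIRST REFUSAL on this file was offered to leaf-06 g46
(Q-p2g41-1, journal l.44762 ∕ l.44977); drafted by road-P2 so the tower's (I4) exists at every level — the bytes are leaf-06's as a packet on «MINE».
HONEST FRAMING (cell contract, verbatim): «discharging `BetaPertH` makes Bałaban's UV stability UNCONDITIONAL — a real constructive-QFT result; it is NOT the continuum limit and NOT
the Clay problem.»  HONEST DEPENDENCY (verbatim): «continuum YM on T⁴ ⇐ BetaPertH ∧ nine spine estimates (0/9 proved); BetaPertH ⇐ (D1) ∧ (D4) ∧ CAP+tail; G-an2-4 gates asym,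
D1 and NE2/3/4.»

* §1 `summable_wΦ_mul_col` (the value-Hessian row against a decaying column is summable), **`fieldRow_eq_of_relInv_step`**: `RelInv G (bhKStep d Lc (j+1)) (axEc ρ Lc)`, `G W` spread ⇒
  on every NON-comb bond `(κ,u)`: `wVH_{j+1}·Σ'_v Σ_l wΦ_{Lc^{j+1}} κ l (u − v)·(G∘W) v x (inl l) b − stepScale_{j+1}·𝒬ᵀ_{Lc}(mcol (G∘W) x b) κ u = W u x (inl κ) b` (rule 4).
* §2 `tsum_sum_mul_tsum_sum_wΦ_comm` (Fubini: a bounded 1-form against the value-Hessian image of a decaying column = the value-Hessian image of the form against the column;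
  `wΦ_symm`).
* §3 **`ward_pairing_step`**: for `m` BOUNDED and ZERO ON THE COMB BONDS,
  `Σ'_u Σ_κ (wVH_{j+1}·Σ'_v Σ_l wΦ_{Lc^{j+1}} κ l (u − v)·m l v)·(G∘W) u x (inl κ) b = Σ'_u Σ_κ m κ u·W u x (inl κ) b + stepScale_{j+1}·Σ'_y Σ_κ (𝒬_{Lc} m) κ y·(G∘W) (Lc•y) x (inr κ) b`
  — the `Δ_{j+1}`-image of `m` read against a field column of `G∘W` is the source read against `m` plus `stepScale` × the block contour sums of `m` read against the MULTIPLIER column.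
* §4 the instance **`ward_pairing_coDressKBmAt_KInvStep_succ`** (`G_{j+1} = coDressKBmAt (toSite r) Lc (KInvStep Lc (j+1))`, in-block root, every `j`, every spread `W`).
* §5 **`tsum_E2image_mul_colH_eq`** (§4 at `W = idK`): the `Δ_{j+1}`-image of `m` read against an `ℋ`-column of `G_{j+1}` = `stepScale_{j+1}·Σ'_y Σ_κ (𝒬m) κ y·G_{j+1}(Lc•y)(Lc•y′)(inr κ)(inr ν)` —
  the form the charge tower consumes (the right side is the `(G_{j+1})_{mm}`-image of `𝒬m` = the next level's potential).
READING: with leaf-06's `j = 0` file this gives (I4) of the tower at EVERY level; the tower consumes it at `W = ` a unit source (column orthogonality, leaf-06 INTENT 3 §2's shape).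
Asserts NO value of Bałaban's tables; discharges NOTHING of (W-γ) ∕ (INV) ∕ (S) ∕ (Q-R) ∕ (LT) ∕ (Q-L) ∕ (C) ∕ «T2Shape» ∕ «T2Drift» ∕ (hW, hWall); NEVER «G-an2-4 closed» as (CONV-C);
NOT D1, NOT `BetaPertH`, NOT continuum, NOT Clay.  2026-08-22; no existing file touched.
-/

noncomputable section

open Finset
open scoped BigOperators
open Literature.Probability.LatticeModels (Torus.proj)
open Literature.MathematicalPhysics.QuantumFieldTheory
open Literature.MathematicalPhysics.QuantumFieldTheory.Balaban1983to89
open Literature.MathematicalPhysics.QuantumFieldTheory.Balaban1983to89.Beta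
open B12Sec2to5 (l1 l1_nonneg)
open ExpKernelCalculus (Site MKer Decays comp summable_exp_shift summable_exp_shift' tsum_exp_shift')
open AffineAveraging (Form1 box toSite unitVec contourSum)
open AffineReproduction (contourSumAdj)
open LatticeForm (quo)
open KKTFluctuationEnergy (contourSumAdj_eq)
open KernelSpecInstance (wΦ)
open OneStepResolventKernel (Fib)
open OneStepKernelFamily (KInvStep)
open BalabanStepJetsSucc (wVH)
open Summit.QuantumFields.BalabanUV.Beta.TameKernelCalculus
open HessKerSchurResolvent (idK idK_apply comp_idK_right)
open Summit.QuantumFields.BalabanUV.Beta.ChartConjugationRelative (RelInv spr_comp)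
open Summit.QuantumFields.BalabanUV.Beta.AxialDressingRooted (IsCombBondAt axEc comp_axEc_apply spr_axEc coDressKBmAt spr_coDressKBmAt one_le_of_neZero)
open Summit.QuantumFields.BalabanUV.Beta.BorderedHessian (fcol mcol fcol_apply mcol_apply stepScale bhKStep spr_bhKStep comp_bhKStep_succ_inl spr_KInvStep
  relInv_coDressKBmAt_KInvStep_succ_bhKStep exists_abs_wΦ_le)
open Summit.QuantumFields.BalabanUV.Beta.GAN24.MultiplierZeroMass (summable_wΦ)
open Summit.QuantumFields.BalabanUV.Beta.GAN24.TransverseDictionary (wΦ_symm)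
open Summit.QuantumFields.BalabanUV.Beta.GAN24.RelInvWardPairing (summable_bdd_mul tsum_mul_contourSumAdj_bdd summable_abs_comp_quo)

namespace Summit.QuantumFields.BalabanUV.Beta.GAN24.RelInvWardPairingStep

variable {d : ℕ} {Lc : ℕ} [NeZero Lc]

/-! ## §1 The field rows of rule `(E ∘ 𝕄_{j+1}) ∘ G = E` on the free bonds -/

/-- [folklore] The value-Hessian row against a decaying column is summable: `v ↦ Σ_l wΦ κ l (u − v)·V v x (inl l) b` (`wΦ` bounded, `V` spread). -/
theorem summable_wΦ_mul_col (M : ℕ) [NeZero M] {V : MKer (d + 1) (Fib d)} {C δ : ℝ} (hV : Decays V C δ) (hδ : 0 < δ)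
    (κ : Fin (d + 1)) (u x : Site (d + 1)) (b : Fib d) :
    Summable fun v : Site (d + 1) => ∑ l : Fin (d + 1), wΦ (N := M) κ l (u - v) * V v x (Sum.inl l) b := by
  obtain ⟨A, hA⟩ := exists_abs_wΦ_le (N := M) (d := d)
  refine summable_sum fun l _ => ?_
  refine Summable.of_norm_bounded (g := fun v => A * (C * Real.exp (-δ * l1 (v - x)))) (((summable_exp_shift' hδ x).mul_left C).mul_left A)
    fun v => ?_
  rw [Real.norm_eq_abs, abs_mul]
  exact mul_le_mul (hA κ l (u - v)) (hV v x (Sum.inl l) b) (abs_nonneg _) ((abs_nonneg _).trans (hA κ l (u - v)))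

/-- NOT IN PRINT; OUR BOOKKEEPING.  **THE FIELD ROWS OF RULE `(E ∘ 𝕄_{j+1}) ∘ G = E` ON THE FREE BONDS** (leaf-06's `fieldRow_eq_of_relInv` with an2's straight step candidate):
from `RelInv G (bhKStep d Lc (j+1)) (axEc ρ Lc)` and spread `G`, `W`, on every NON-comb fine bond `(κ, u)`
`wVH_{j+1}·Σ'_v Σ_l wΦ_{Lc^{j+1}} κ l (u − v)·(G∘W) v x (inl l) b − stepScale_{j+1}·𝒬ᵀ_{Lc}(mcol (G∘W) x b) κ u = W u x (inl κ) b`. -/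
theorem fieldRow_eq_of_relInv_step {ρ : Fin (d + 1) → ℤ} (j : ℕ) {G W : MKer (d + 1) (Fib d)}
    (hG : RelInv G (bhKStep d Lc (j + 1)) (axEc ρ Lc)) (hGs : Spr G) (hWs : Spr W) {κ : Fin (d + 1)} {u : Fin (d + 1) → ℤ}
    (hu : ¬ IsCombBondAt ρ Lc κ u) (x : Fin (d + 1) → ℤ) (b : Fib d) :
    wVH d Lc (j + 1) * (∑' v, ∑ l : Fin (d + 1), wΦ (N := Lc ^ (j + 1)) κ l (u - v) * comp G W v x (Sum.inl l) b)
      - stepScale d Lc (j + 1) * contourSumAdj Lc (mcol Lc (comp G W) x b) κ u = W u x (Sum.inl κ) b := by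
  have hE : Spr (axEc ρ Lc) := spr_axEc ρ Lc
  have hB : Spr (bhKStep d Lc (j + 1)) := spr_bhKStep (j + 1)
  have hV : Spr (comp G W) := spr_comp hGs hWs
  obtain ⟨C, δ, hδ, hVd⟩ := hV
  have key : comp (comp (axEc ρ Lc) (bhKStep d Lc (j + 1))) (comp G W) = comp (axEc ρ Lc) W := by
    rw [comp_assoc_tame (spr_comp hE hB).tame hGs.tame hWs.tame, hG.2.2.2]
  have key' : comp (axEc ρ Lc) (comp (bhKStep d Lc (j + 1)) (comp G W)) = comp (axEc ρ Lc) W := by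
    rw [comp_assoc_tame hE.tame hB.tame (spr_comp hGs hWs).tame]; exact key
  have e1 := congrArg (fun K => K u x (Sum.inl κ) b) key'
  simp only [comp_axEc_apply, hu, if_false] at e1
  rw [comp_bhKStep_succ_inl j (comp G W) u x κ b (summable_wΦ_mul_col (Lc ^ (j + 1)) hVd hδ κ u x b)] at e1
  exact e1

/-! ## §2 The value Hessian moves onto the bounded form (Fubini + symmetry) -/

/-- [folklore] **FUBINI FOR THE VALUE-HESSIAN PAIRING**: for a bounded 1-form `m` and a spread kernel `V`,
`Σ'_u Σ_κ m κ u·(Σ'_v Σ_l wΦ κ l (u − v)·V v x (inl l) b) = Σ'_v Σ_l (Σ'_u Σ_κ wΦ l κ (v − u)·m κ u)·V v x (inl l) b` (absolute summability: `m` bounded, `wΦ` summable, `V` decaying;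
`wΦ κ l (u − v) = wΦ l κ (v − u)` by `wΦ_symm`). -/
theorem tsum_sum_mul_tsum_sum_wΦ_comm (M : ℕ) [NeZero M] {V : MKer (d + 1) (Fib d)} {C δ : ℝ} (hV : Decays V C δ) (hδ : 0 < δ)
    {m : Form1 (d + 1) ℝ} {B : ℝ} (hmB : ∀ κ u, |m κ u| ≤ B) (x : Site (d + 1)) (b : Fib d) :
    ∑' u, ∑ κ, m κ u * (∑' v, ∑ l : Fin (d + 1), wΦ (N := M) κ l (u - v) * V v x (Sum.inl l) b)
      = ∑' v, ∑ l : Fin (d + 1), (∑' u, ∑ κ, wΦ (N := M) l κ (v - u) * m κ u) * V v x (Sum.inl l) b := by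
  classical
  have hC : 0 ≤ C := hV.nonneg (Sum.inl 0)
  have hB0 : 0 ≤ B := (abs_nonneg _).trans (hmB 0 0)
  -- the four-index family `(u, v) ↦ Σ_κ Σ_l m κ u · wΦ κ l (u − v) · V v x (inl l) b`
  set F : Site (d + 1) → Site (d + 1) → ℝ := fun u v => ∑ κ, ∑ l : Fin (d + 1), m κ u * (wΦ (N := M) κ l (u - v) * V v x (Sum.inl l) b) with hF
  -- majorant: `Σ_κ Σ_l B·|wΦ κ l (u − v)|·C e^{−δ|v − x|}`
  set G' : Site (d + 1) → Site (d + 1) → ℝ := fun u v => ∑ κ, ∑ l : Fin (d + 1), B * (|wΦ (N := M) κ l (u - v)| * (C * Real.exp (-δ * l1 (v - x)))) with hG'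
  have hFG : ∀ u v, |F u v| ≤ G' u v := by
    intro u v
    refine (Finset.abs_sum_le_sum_abs _ _).trans (Finset.sum_le_sum fun κ _ => (Finset.abs_sum_le_sum_abs _ _).trans (Finset.sum_le_sum fun l _ => ?_))
    rw [abs_mul, abs_mul]
    exact mul_le_mul (hmB κ u) (mul_le_mul_of_nonneg_left (hV v x (Sum.inl l) b) (abs_nonneg _)) (by positivity) hB0
  have hG0 : ∀ u v, 0 ≤ G' u v := fun u v => Finset.sum_nonneg fun κ _ => Finset.sum_nonneg fun l _ => by positivity
  -- summability of the majorant on `Site × Site` (outer `v`, inner `u`)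
  have hGin : ∀ v, HasSum (fun u => G' u v) (∑ κ, ∑ l : Fin (d + 1), B * ((∑' z : Site (d + 1), |wΦ (N := M) κ l z|) * (C * Real.exp (-δ * l1 (v - x))))) := by
    intro v
    refine hasSum_sum fun κ _ => hasSum_sum fun l _ => ?_
    have h1 : HasSum (fun u : Site (d + 1) => |wΦ (N := M) κ l (u - v)|) (∑' z : Site (d + 1), |wΦ (N := M) κ l z|) := by
      have hs : Summable fun z : Site (d + 1) => |wΦ (N := M) κ l z| := (summable_wΦ (N := M) κ l).abs
      have := ((Equiv.subRight v).hasSum_iff).2 hs.hasSum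
      exact this
    exact ((h1.mul_right _).mul_left _)
  have hGs : Summable (Function.uncurry fun v u => G' u v) := by
    refine (summable_prod_of_nonneg (fun s => hG0 s.2 s.1)).2 ⟨fun v => (hGin v).summable, ?_⟩
    have e : (fun v => ∑' u, G' u v) = fun v => (∑ κ, ∑ l : Fin (d + 1), B * ((∑' z : Site (d + 1), |wΦ (N := M) κ l z|) * C)) * Real.exp (-δ * l1 (v - x)) := by
      funext v; rw [(hGin v).tsum_eq, Finset.sum_mul]
      refine Finset.sum_congr rfl fun κ _ => ?_
      rw [Finset.sum_mul]; exact Finset.sum_congr rfl fun l _ => by ring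
    rw [e]; exact (summable_exp_shift' hδ x).mul_left _
  have hFs : Summable (Function.uncurry fun v u => F u v) :=
    Summable.of_norm_bounded hGs (fun s => by rw [Real.norm_eq_abs]; exact hFG s.2 s.1)
  -- LHS = Σ'_u Σ'_v F u v
  have hL : ∀ u, ∑ κ, m κ u * (∑' v, ∑ l : Fin (d + 1), wΦ (N := M) κ l (u - v) * V v x (Sum.inl l) b) = ∑' v, F u v := by
    intro u
    have hs : ∀ κ, Summable fun v => ∑ l : Fin (d + 1), wΦ (N := M) κ l (u - v) * V v x (Sum.inl l) b := fun κ => summable_wΦ_mul_col M hV hδ κ u x b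
    rw [show (fun v => F u v) = fun v => ∑ κ, m κ u * ∑ l : Fin (d + 1), wΦ (N := M) κ l (u - v) * V v x (Sum.inl l) b from by
      funext v; simp only [hF]; exact Finset.sum_congr rfl fun κ _ => by rw [Finset.mul_sum]]
    rw [Summable.tsum_finsetSum (fun κ _ => (hs κ).mul_left _)]
    exact Finset.sum_congr rfl fun κ _ => by rw [tsum_mul_left]
  -- RHS = Σ'_v Σ'_u F u v
  have hR : ∀ v, ∑ l : Fin (d + 1), (∑' u, ∑ κ, wΦ (N := M) l κ (v - u) * m κ u) * V v x (Sum.inl l) b = ∑' u, F u v := by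
    intro v
    have hs : ∀ l, Summable fun u => ∑ κ, wΦ (N := M) l κ (v - u) * m κ u := fun l =>
      summable_sum fun κ _ => by
        have h := summable_bdd_mul (hmB κ) ((Equiv.subLeft v).summable_iff.2 (summable_wΦ (N := M) l κ)).abs
        refine (h.congr fun u => ?_)
        simp [Equiv.subLeft, mul_comm]
    rw [show (fun u => F u v) = fun u => ∑ l : Fin (d + 1), (∑ κ, wΦ (N := M) l κ (v - u) * m κ u) * V v x (Sum.inl l) b from by
      funext u; simp only [hF]; rw [Finset.sum_comm]
      refine Finset.sum_congr rfl fun l _ => ?_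
      rw [Finset.sum_mul]
      exact Finset.sum_congr rfl fun κ _ => by rw [wΦ_symm κ l (u - v), neg_sub]; ring]
    rw [Summable.tsum_finsetSum (fun l _ => (hs l).mul_right _)]
    exact Finset.sum_congr rfl fun l _ => by rw [tsum_mul_right]
  rw [tsum_congr hL, tsum_congr hR]
  exact hFs.tsum_comm

/-! ## §3 The Ward pairing at step `j + 1` -/

/-- NOT IN PRINT; OUR BOOKKEEPING.  **THE RELATIVE-INVERSE WARD PAIRING AT STEP `j + 1`**: `RelInv G (bhKStep d Lc (j+1)) (axEc ρ Lc)`, `G W` spread, `m` a BOUNDED fine 1-form VANISHING ON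
THE COMB BONDS; then for every `(x, b)`
`Σ'_u Σ_κ (wVH_{j+1}·Σ'_v Σ_l wΦ_{Lc^{j+1}} κ l (u − v)·m l v)·(G∘W) u x (inl κ) b = Σ'_u Σ_κ m κ u·W u x (inl κ) b + stepScale_{j+1}·Σ'_y Σ_κ (𝒬_{Lc} m) κ y·(G∘W) (Lc•y) x (inr κ) b`. -/
theorem ward_pairing_step {ρ : Fin (d + 1) → ℤ} (j : ℕ) {G W : MKer (d + 1) (Fib d)}
    (hG : RelInv G (bhKStep d Lc (j + 1)) (axEc ρ Lc)) (hGs : Spr G) (hWs : Spr W) {m : Form1 (d + 1) ℝ} {B : ℝ} (hmB : ∀ κ u, |m κ u| ≤ B)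
    (hm0 : ∀ κ u, IsCombBondAt ρ Lc κ u → m κ u = 0) (x : Fin (d + 1) → ℤ) (b : Fib d) :
    ∑' u, ∑ κ, (wVH d Lc (j + 1) * ∑' v, ∑ l : Fin (d + 1), wΦ (N := Lc ^ (j + 1)) κ l (u - v) * m l v) * comp G W u x (Sum.inl κ) b
      = (∑' u, ∑ κ, m κ u * W u x (Sum.inl κ) b)
        + stepScale d Lc (j + 1) * ∑' y, ∑ κ, contourSum Lc m κ y * comp G W ((Lc : ℤ) • y) x (Sum.inr κ) b := by
  classical
  have hLc : 1 ≤ Lc := one_le_of_neZero Lc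
  obtain ⟨C, δ, hδ, hVd⟩ := spr_comp hGs hWs
  -- summabilities
  have hφ : ∀ κ, Summable fun u : Fin (d + 1) → ℤ => |mcol Lc (comp G W) x b κ (quo Lc u)| := fun κ =>
    summable_abs_comp_quo hLc hδ hVd x (Sum.inr κ) b
  have hφs : ∀ κ (c : Fin (d + 1) → ℤ), Summable fun u : Fin (d + 1) → ℤ => |mcol Lc (comp G W) x b κ (quo Lc (u - c))| := fun κ c =>
    (Equiv.subRight c).summable_iff.2 (hφ κ)
  have hcolA : ∀ κ, Summable fun u => |∑' v, ∑ l : Fin (d + 1), wΦ (N := Lc ^ (j + 1)) κ l (u - v) * comp G W v x (Sum.inl l) b| := by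
    -- the value-Hessian image of a decaying column is summable in `u`: Fubini on the product family with majorant `|wΦ(u−v)|·C e^{−δ|v−x|}`
    intro κ
    obtain ⟨A, hA⟩ := exists_abs_wΦ_le (N := Lc ^ (j + 1)) (d := d)
    have hC : 0 ≤ C := hVd.nonneg (Sum.inl 0)
    set P : Site (d + 1) → Site (d + 1) → ℝ := fun v u => ∑ l : Fin (d + 1), wΦ (N := Lc ^ (j + 1)) κ l (u - v) * comp G W v x (Sum.inl l) b with hP
    set Q : Site (d + 1) → Site (d + 1) → ℝ := fun v u => ∑ l : Fin (d + 1), |wΦ (N := Lc ^ (j + 1)) κ l (u - v)| * (C * Real.exp (-δ * l1 (v - x))) with hQ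
    have hPQ : ∀ v u, |P v u| ≤ Q v u := fun v u =>
      (Finset.abs_sum_le_sum_abs _ _).trans (Finset.sum_le_sum fun l _ => by
        rw [abs_mul]; exact mul_le_mul_of_nonneg_left (hVd v x (Sum.inl l) b) (abs_nonneg _))
    have hQ0 : ∀ v u, 0 ≤ Q v u := fun v u => Finset.sum_nonneg fun l _ => by positivity
    have hQin : ∀ v, HasSum (fun u => Q v u) (∑ l : Fin (d + 1), (∑' z : Site (d + 1), |wΦ (N := Lc ^ (j + 1)) κ l z|) * (C * Real.exp (-δ * l1 (v - x)))) := by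
      intro v
      refine hasSum_sum fun l _ => ?_
      have hs : Summable fun z : Site (d + 1) => |wΦ (N := Lc ^ (j + 1)) κ l z| := (summable_wΦ (N := Lc ^ (j + 1)) κ l).abs
      exact (((Equiv.subRight v).hasSum_iff).2 hs.hasSum).mul_right _
    have hQs : Summable (Function.uncurry Q) := by
      refine (summable_prod_of_nonneg (fun s => hQ0 s.1 s.2)).2 ⟨fun v => (hQin v).summable, ?_⟩
      have e : (fun v => ∑' u, Q v u) = fun v => (∑ l : Fin (d + 1), (∑' z : Site (d + 1), |wΦ (N := Lc ^ (j + 1)) κ l z|) * C) * Real.exp (-δ * l1 (v - x)) := by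
        funext v; rw [(hQin v).tsum_eq, Finset.sum_mul]; exact Finset.sum_congr rfl fun l _ => by ring
      rw [e]; exact (summable_exp_shift' hδ x).mul_left _
    have hPs : Summable (Function.uncurry P) := Summable.of_norm_bounded hQs (fun s => by rw [Real.norm_eq_abs]; exact hPQ s.1 s.2)
    exact hPs.prod_symm.prod.abs
  have s1 : Summable fun u => ∑ κ, m κ u * (wVH d Lc (j + 1) * ∑' v, ∑ l : Fin (d + 1), wΦ (N := Lc ^ (j + 1)) κ l (u - v) * comp G W v x (Sum.inl l) b) :=
    summable_sum fun κ _ => by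
      have h := (summable_bdd_mul (hmB κ) (hcolA κ)).mul_left (wVH d Lc (j + 1))
      exact h.congr fun u => by ring
  have s2 : Summable fun u => ∑ κ, m κ u * (stepScale d Lc (j + 1) * contourSumAdj Lc (mcol Lc (comp G W) x b) κ u) := by
    refine summable_sum fun κ _ => ?_
    have e : (fun u => m κ u * (stepScale d Lc (j + 1) * contourSumAdj Lc (mcol Lc (comp G W) x b) κ u))
        = fun u => ∑ s ∈ Finset.range Lc, stepScale d Lc (j + 1) * (m κ u * mcol Lc (comp G W) x b κ (quo Lc (u - (s : ℤ) • unitVec κ))) := by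
      funext u; rw [contourSumAdj_eq, Finset.mul_sum, Finset.mul_sum]
      exact Finset.sum_congr rfl fun s _ => by ring
    rw [e]
    exact summable_sum fun s _ => (summable_bdd_mul (hmB κ) (hφs κ _)).mul_left _
  -- the pointwise identity, summed
  have hpt : ∀ u, (∑ κ, m κ u * (wVH d Lc (j + 1) * ∑' v, ∑ l : Fin (d + 1), wΦ (N := Lc ^ (j + 1)) κ l (u - v) * comp G W v x (Sum.inl l) b))
      - (∑ κ, m κ u * (stepScale d Lc (j + 1) * contourSumAdj Lc (mcol Lc (comp G W) x b) κ u))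
      = ∑ κ, m κ u * W u x (Sum.inl κ) b := by
    intro u
    rw [← Finset.sum_sub_distrib]
    refine Finset.sum_congr rfl fun κ _ => ?_
    by_cases hc : IsCombBondAt ρ Lc κ u
    · simp [hm0 κ u hc]
    · rw [← mul_sub, fieldRow_eq_of_relInv_step j hG hGs hWs hc x b]
  have hsum : (∑' u, ∑ κ, m κ u * (wVH d Lc (j + 1) * ∑' v, ∑ l : Fin (d + 1), wΦ (N := Lc ^ (j + 1)) κ l (u - v) * comp G W v x (Sum.inl l) b))
      - (∑' u, ∑ κ, m κ u * (stepScale d Lc (j + 1) * contourSumAdj Lc (mcol Lc (comp G W) x b) κ u))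
      = ∑' u, ∑ κ, m κ u * W u x (Sum.inl κ) b := by
    rw [← s1.tsum_sub s2]; exact tsum_congr hpt
  -- move the value Hessian onto `m` (§2) and `𝒬ᵀ` onto `m` (leaf-06's adjointness)
  have eA : (∑' u, ∑ κ, m κ u * (wVH d Lc (j + 1) * ∑' v, ∑ l : Fin (d + 1), wΦ (N := Lc ^ (j + 1)) κ l (u - v) * comp G W v x (Sum.inl l) b))
      = wVH d Lc (j + 1) * ∑' v, ∑ l : Fin (d + 1), (∑' u, ∑ κ, wΦ (N := Lc ^ (j + 1)) l κ (v - u) * m κ u) * comp G W v x (Sum.inl l) b := by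
    rw [← tsum_sum_mul_tsum_sum_wΦ_comm (Lc ^ (j + 1)) hVd hδ hmB x b, ← tsum_mul_left]
    refine tsum_congr fun u => ?_
    rw [Finset.mul_sum]
    exact Finset.sum_congr rfl fun κ _ => by ring
  have eB : (∑' u, ∑ κ, m κ u * (stepScale d Lc (j + 1) * contourSumAdj Lc (mcol Lc (comp G W) x b) κ u))
      = stepScale d Lc (j + 1) * ∑' y, ∑ κ, contourSum Lc m κ y * comp G W ((Lc : ℤ) • y) x (Sum.inr κ) b := by
    have h := tsum_mul_contourSumAdj_bdd (N := Lc) hmB hφ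
    have e2 : (fun y => ∑ κ, mcol Lc (comp G W) x b κ y * contourSum Lc m κ y)
        = fun y => ∑ κ, contourSum Lc m κ y * comp G W ((Lc : ℤ) • y) x (Sum.inr κ) b := by
      funext y; exact Finset.sum_congr rfl fun κ _ => by rw [mcol_apply, mul_comm]
    rw [e2] at h
    rw [← h, ← tsum_mul_left]
    refine tsum_congr fun u => ?_
    rw [Finset.mul_sum]
    exact Finset.sum_congr rfl fun κ _ => by ring
  rw [eA, eB] at hsum
  -- rename the bound variables on the left and finish
  have eL : (∑' u, ∑ κ, (wVH d Lc (j + 1) * ∑' v, ∑ l : Fin (d + 1), wΦ (N := Lc ^ (j + 1)) κ l (u - v) * m l v) * comp G W u x (Sum.inl κ) b)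
      = wVH d Lc (j + 1) * ∑' v, ∑ l : Fin (d + 1), (∑' u, ∑ κ, wΦ (N := Lc ^ (j + 1)) l κ (v - u) * m κ u) * comp G W v x (Sum.inl l) b := by
    rw [← tsum_mul_left]
    refine tsum_congr fun u => ?_
    rw [Finset.mul_sum]
    exact Finset.sum_congr rfl fun κ _ => by ring
  rw [eL]
  linarith

/-! ## §4 The instance `G_{j+1} = coDressKBmAt (toSite r) Lc (KInvStep Lc (j+1))` -/

/-- NOT IN PRINT; OUR BOOKKEEPING.  **THE WARD PAIRING FOR THE CO-DRESSED STEP RESOLVENT AT EVERY STEP `j + 1`** (in-block root): an2's `relInv_coDressKBmAt_KInvStep_succ_bhKStep` +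
`spr_coDressKBmAt` ∘ `spr_KInvStep` BY NAME in `ward_pairing_step`, for every spread `W` and every bounded `m` vanishing on the comb bonds of the root. -/
theorem ward_pairing_coDressKBmAt_KInvStep_succ {r : Fin (d + 1) → ℕ} (hr : r ∈ box (d + 1) Lc) (j : ℕ)
    {W : MKer (d + 1) (Fib d)} (hWs : Spr W) {m : Form1 (d + 1) ℝ} {B : ℝ} (hmB : ∀ κ u, |m κ u| ≤ B)
    (hm0 : ∀ κ u, IsCombBondAt (toSite r) Lc κ u → m κ u = 0) (x : Fin (d + 1) → ℤ) (b : Fib d) :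
    ∑' u, ∑ κ, (wVH d Lc (j + 1) * ∑' v, ∑ l : Fin (d + 1), wΦ (N := Lc ^ (j + 1)) κ l (u - v) * m l v)
        * comp (coDressKBmAt (toSite r) Lc (KInvStep (d := d) Lc (j + 1))) W u x (Sum.inl κ) b
      = (∑' u, ∑ κ, m κ u * W u x (Sum.inl κ) b)
        + stepScale d Lc (j + 1) * ∑' y, ∑ κ, contourSum Lc m κ y
            * comp (coDressKBmAt (toSite r) Lc (KInvStep (d := d) Lc (j + 1))) W ((Lc : ℤ) • y) x (Sum.inr κ) b :=
  ward_pairing_step j (relInv_coDressKBmAt_KInvStep_succ_bhKStep hr j)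
    (spr_coDressKBmAt (one_le_of_neZero Lc) hr (spr_KInvStep (j + 1))) hWs hmB hm0 x b

/-! ## §5 The column pairing (the tower's use: `W` = the identity source) -/

/-- NOT IN PRINT; OUR BOOKKEEPING.  **THE LEVEL-(j+1) COLUMN PAIRING** (in-block root, every `j`, `m` bounded and zero on the comb bonds): the `Δ_{j+1}`-image of `m` read against an
`ℋ`-COLUMN of `G_{j+1}` is `stepScale_{j+1}` × the block contour sums of `m` read against the MULTIPLIER column —
`Σ'_u Σ_κ (wVH_{j+1}·Σ'_v Σ_l wΦ_{Lc^{j+1}} κ l (u − v)·m l v)·G_{j+1} u (Lc•y′) (inl κ)(inr ν) = stepScale_{j+1}·Σ'_y Σ_κ (𝒬_{Lc} m) κ y·G_{j+1} (Lc•y) (Lc•y′) (inr κ)(inr ν)`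
(§4 at `W = idK`: the source term is `idK`'s `(inl, inr)` block, zero — leaf-06's INTENT 3 §2 pattern one level up, WITHOUT the periodicity∕zero-`mm`-mass step: for the tower's
`Lc^m`-periodic potentials `𝒬 m` is not block-constant and the right side is the `E2_{j+2}`-image `(G_{j+1})_{mm}·𝒬m` — the next potential). -/
theorem tsum_E2image_mul_colH_eq {r : Fin (d + 1) → ℕ} (hr : r ∈ box (d + 1) Lc) (j : ℕ) {m : Form1 (d + 1) ℝ} {B : ℝ} (hmB : ∀ κ u, |m κ u| ≤ B)
    (hm0 : ∀ κ u, IsCombBondAt (toSite r) Lc κ u → m κ u = 0) (ν : Fin (d + 1)) (y' : Fin (d + 1) → ℤ) :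
    ∑' u, ∑ κ, (wVH d Lc (j + 1) * ∑' v, ∑ l : Fin (d + 1), wΦ (N := Lc ^ (j + 1)) κ l (u - v) * m l v)
        * coDressKBmAt (toSite r) Lc (KInvStep (d := d) Lc (j + 1)) u ((Lc : ℤ) • y') (Sum.inl κ) (Sum.inr ν)
      = stepScale d Lc (j + 1) * ∑' y, ∑ κ, contourSum Lc m κ y
          * coDressKBmAt (toSite r) Lc (KInvStep (d := d) Lc (j + 1)) ((Lc : ℤ) • y) ((Lc : ℤ) • y') (Sum.inr κ) (Sum.inr ν) := by
  classical
  have hW := ward_pairing_coDressKBmAt_KInvStep_succ hr j (W := idK) spr_idK hmB hm0 ((Lc : ℤ) • y') (Sum.inr ν)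
  rw [comp_idK_right] at hW
  rw [hW]
  have h1 : (fun u => ∑ κ, m κ u * (idK : MKer (d + 1) (Fib d)) u ((Lc : ℤ) • y') (Sum.inl κ) (Sum.inr ν)) = fun _ => 0 := by
    funext u
    refine Finset.sum_eq_zero fun κ _ => ?_
    rw [idK_apply, if_neg (fun h => Sum.inl_ne_inr h.2), mul_zero]
  rw [h1, tsum_zero, zero_add]

end Summit.QuantumFields.BalabanUV.Beta.GAN24.RelInvWardPairingStep

end
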